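import Summits.CriticalPhenomena.CardyFormulaZ2.Theorems.CardyBoundaryCoulombGasBoundaryDefectGaussianRS17HeightsExistPart3
import Summits.CriticalPhenomena.CardyFormulaZ2.Theorems.CardyBoundaryCoulombGasBoundaryDefectGaussianRS17HeightsExistPart4
import Summits.CriticalPhenomena.CardyFormulaZ2.Theorems.CardyBoundaryCoulombGasBoundaryDefectGaussianRS17ForcedBits

/-!
# Stub `s17_heightsExist` of line `rainbow-monomials-in-excursion-kernels` — Part 5 (assembly):
# heights exist for every consistent arrow assignment on a rainbow configuration (T5c of D2)
# (crux `BoundaryDefectGaussianR`, stmt-CriticalPhenomena-14132)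

THEOREM (`s17_heightsExist`, registered on the crux item; `he_heightsExist`). Let `ι` be an ADMISSIBLE
leg insertion on `V` with FLAT insertion points (radius `sinkLegs + 4`), radius-`3` CHARTS at the
boundary vertices, `V` lattice-connected with king-connected complement and `6`-KINGCHARTS at the
first-layer points; `M = ι.model V` its jump collar, `h₀ ∈ M.configs` a valid height configuration,
`ω ⊆ E` a RAINBOW configuration and `s` an arrow assignment on the corners that is invariant under the
turning rule of `cfgOf ω` at the non-cut corners over the piece and equals `bit h₀` at the cuts. Then
some valid `h ∈ M.configs` has `bit h c = s c` at every corner `c` over the piece.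

Proof (Parts 1–4). Put `w = sgn s - sgn (bit h₀)` and `H(F) = ∑_c w(c) dartWnd(cornerDart c, F)` on
the unit squares `F` of the medial lattice, and `h = h₀ + H` on the free cells (`H` read at the vertex
square `vcell x` / face square `fcell f`). By the cycle condition (Part 2) `H` jumps by exactly `w(c)`
from `vcell x` to `fcell f` across every corner `c = (x, f)` over the piece (Part 1), and `H = 0` at
every PRESCRIBED cell: ghosts and arc vertices (Part 3), collar faces (`he_H_face`: through an outside
corner that is no vertex-cell, `H` being `0` outside the cell region by co-hole-freeness, or through a
prescribed corner, where `w = 0` by Part 4). Hence `hv h x - hf h f = (hv h₀ x - hf h₀ f) + w(c) =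
sgn (bit h₀ c) + sgn (s c) - sgn (bit h₀ c) = sgn (s c) = ±1` at every tracked corner (Lemma V for
`h₀`): `h` is valid and its bits are `s`; at an untracked corner over the piece both cells are
prescribed and the corner is a cut, where `s = bit h₀ = bit h`.
-/

namespace Summit.CriticalPhenomena.CardyFormulaZ2.Cruxes.BoundaryDefectGaussianR.RainbowMonomialsInExcursionKernels

open Finset Literature.Probability.LatticeModels Literature.Probability.LatticeModels.CollarLegModel
open Literature.Probability.Percolation Literature.Probability.LatticeModels.MedialTrail
open Literature.Probability.Percolation.CellComplex

/-- `toSite ∘ ofSite = id` (file-local copy of a bookkeeping identity). [folklore] -/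
private theorem he_toSite_ofSite (y : Site 2) : toSite (ofSite y) = y := by
  funext i; fin_cases i <;> simp [toSite, ofSite]

/-- The sign of the bit of a unit difference is the difference. [folklore] -/
theorem he_sgn_decide {d : ℤ} (hd : |d| = 1) : BKW.sgn (decide (d = 1)) = d := by
  rw [abs_eq (zero_le_one' ℤ)] at hd
  rcases hd with rfl | rfl <;> simp [BKW.sgn]

section Model

variable (ι : LegInsertionData) (V : Finset (ℤ × ℤ)) (hadm : ι.IsAdmissible V)
  (hflat : ∀ x ∈ insert ι.sink ι.source, ∃ dvec : ℤ × ℤ,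
    (dvec = (1, 0) ∨ dvec = (-1, 0) ∨ dvec = (0, 1) ∨ dvec = (0, -1)) ∧
    ∀ v : ℤ × ℤ, (v.1 - x.1) ^ 2 + (v.2 - x.2) ^ 2 ≤ ((ι.sinkLegs : ℤ) + 4) ^ 2 →
      (v ∈ V ↔ 0 ≤ (v.1 - x.1) * dvec.1 + (v.2 - x.2) * dvec.2))
  (hchart : ∀ u ∈ V, ∀ k : Fin 4, u + dir k ∉ V → ∃ (K : Fin 4) (c₁ c₂ : ℤ),
    (∀ v : ℤ × ℤ, |v.1 - u.1| ≤ 3 → |v.2 - u.2| ≤ 3 →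
      (v ∈ V ↔ c₂ ≤ v.1 * (dir (K + 1)).1 + v.2 * (dir (K + 1)).2)) ∨
    (∀ v : ℤ × ℤ, |v.1 - u.1| ≤ 3 → |v.2 - u.2| ≤ 3 →
      (v ∈ V ↔ c₁ ≤ v.1 * (dir K).1 + v.2 * (dir K).2 ∧
        c₂ ≤ v.1 * (dir (K + 1)).1 + v.2 * (dir (K + 1)).2)) ∨
    (∀ v : ℤ × ℤ, |v.1 - u.1| ≤ 3 → |v.2 - u.2| ≤ 3 →
      (v ∈ V ↔ c₂ ≤ v.1 * (dir (K + 1)).1 + v.2 * (dir (K + 1)).2 ∨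
        v.1 * (dir K).1 + v.2 * (dir K).2 ≤ c₁)))
  (hK : ∀ u ∉ V, ∀ w ∉ V, Relation.ReflTransGen
    (fun b c : ℤ × ℤ => b ∉ V ∧ c ∉ V ∧ max |b.1 - c.1| |b.2 - c.2| ≤ 1) u w)
  (hLS : ∀ z : ℤ × ℤ, z ∉ V → (∃ v ∈ V, max |v.1 - z.1| |v.2 - z.2| ≤ 1) → ∃ σ τ a c : ℤ, |σ| ≤ 1 ∧ |τ| ≤ 1 ∧
    ((∀ v : ℤ × ℤ, max |v.1 - z.1| |v.2 - z.2| ≤ 6 → (v ∈ V ↔ 0 ≤ σ * (v.1 - a) ∧ 0 ≤ τ * (v.2 - c))) ∨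
     (∀ v : ℤ × ℤ, max |v.1 - z.1| |v.2 - z.2| ≤ 6 → (v ∈ V ↔ 0 < σ * (v.1 - a) ∨ 0 < τ * (v.2 - c)))))
  {h₀ : ↥(ι.model V).freeCells → ℤ} (hh₀ : h₀ ∈ (ι.model V).configs)
  {ω : Finset ((ℤ × ℤ) × Bool)} (hω : ω ⊆ (ι.model V).E) (hR : ι.Rainbow V ω)
  {s : Site 2 × Fin 4 → Bool}
  (hs1 : ∀ c ∈ cornerSet (ι.model V).piece, ¬(ι.model V).IsCut c → s (nextCorner ((ι.model V).cfgOf ω) c) = s c)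
  (hs2 : ∀ c ∈ cornerSet (ι.model V).piece, (ι.model V).IsCut c → s c = (ι.model V).bit h₀ c)

include hadm hflat hchart hK hLS hh₀ hω hR hs1 hs2 in
/-- **`H` vanishes at every prescribed vertex-cell** (arc vertex: Part 3 `he_H_arc` with the exterior
direction of `he_arc_exterior`; ghost: `he_H_ghost`). [folklore] -/
theorem he_H_vertex {x : ℤ × ℤ} (hx : x ∈ (ι.model V).vertexCells) (hxf : (x, false) ∉ (ι.model V).freeCells) :
    (∑ c ∈ cornerSet (ι.model V).piece, (BKW.sgn (s c) - BKW.sgn ((ι.model V).bit h₀ c)) *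
      dartWnd (cornerDart c) (vcell (toSite x))) = 0 := by
  rcases mem_arc_or_ghosts_of_not_mem_freeCells (ι.model V) hx hxf with ⟨hxV, harc⟩ | ⟨-, hg⟩
  · obtain ⟨k, hk⟩ := he_arc_exterior ι V hadm harc
    exact he_H_arc ι V hadm hflat hchart hK hLS hh₀ hω hR hs1 hs2 (mem_inter.2 ⟨harc, hxV⟩) k hk
  · exact he_H_ghost ι V hadm hflat hchart hK hLS hh₀ hω hR hs1 hs2 hg

include hadm hflat hchart hK hLS hh₀ hω hR hs1 hs2 in
/-- **`H` vanishes at every prescribed face-cell** (collar face `f`). If some corner `x` of `f` is a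
prescribed vertex-cell, `H(vcell x) = 0` and the jump of `H` across the prescribed corner `(x, f)` is
`w = 0` (Part 4); otherwise a corner of `f` outside `V` (the face is not interior) is no vertex-cell,
`H` does not jump towards it, and its square is a non-cell next to the cell region, where `H = 0`
(Part 3). [folklore] -/
theorem he_H_face {f : ℤ × ℤ} (hfc : f ∈ (ι.model V).faceCells) (hff : (f, true) ∉ (ι.model V).freeCells) :
    (∑ c ∈ cornerSet (ι.model V).piece, (BKW.sgn (s c) - BKW.sgn ((ι.model V).bit h₀ c)) *
      dartWnd (cornerDart c) (fcell (toSite f))) = 0 := by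
  have hdiv := he_div ι V hadm hflat hchart hh₀ hω hR hs1 hs2
  by_cases hex : ∃ x ∈ SixVertex.faceCorners f, x ∈ (ι.model V).vertexCells ∧ (x, false) ∉ (ι.model V).freeCells
  · obtain ⟨x, hxf, hx, hxfree⟩ := hex
    have hfv : f ∈ SixVertex.vertexFaces x := mem_vertexFaces_of_mem_faceCorners hxf
    obtain ⟨j, hj⟩ := dict_exists_corner_of_vertexFaces hfv
    have hw0 := he_pp_good ι V hadm hflat hchart hh₀ hω hR hs1 hs2 hx hxfree hfv hfc hff j hj
    have hjump := hw_jump_corner _ _ hdiv (toSite x, j)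
    have hc : (toSite x, j) ∈ cornerSet (ι.model V).piece := by
      rw [mem_cornerSet, dict_mem_piece_iff, ofSite_toSite]; exact hx
    rw [if_pos hc, hw0, sub_eq_zero] at hjump
    have hface : cFace (toSite x, j) = toSite f := by rw [← hj, he_toSite_ofSite]
    rw [hface] at hjump
    simp only at hjump
    rw [← hjump]
    exact he_H_vertex ι V hadm hflat hchart hK hLS hh₀ hω hR hs1 hs2 hx hxfree
  · push Not at hex
    obtain ⟨hni, -⟩ := not_mem_of_not_mem_freeCells (ι.model V) hff
    have hsub : ¬ SixVertex.faceCorners f ⊆ V := fun h => hni (mem_filter.2 ⟨hfc, h⟩)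
    obtain ⟨wv, hwf, hwV⟩ := not_subset.1 hsub
    have hwc : wv ∉ (ι.model V).vertexCells := by
      intro hwc
      have := hex wv hwf hwc
      rw [mem_freeCells_false, freeVerts, mem_sdiff] at this
      exact hwV this.1
    have hfv : f ∈ SixVertex.vertexFaces wv := mem_vertexFaces_of_mem_faceCorners hwf
    obtain ⟨j, hj⟩ := dict_exists_corner_of_vertexFaces hfv
    have hjump := hw_jump_corner _ _ hdiv (toSite wv, j)
    have hc : (toSite wv, j) ∉ cornerSet (ι.model V).piece := by
      rw [mem_cornerSet, dict_mem_piece_iff, ofSite_toSite]; exact hwc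
    rw [if_neg hc, sub_eq_zero] at hjump
    have hface : cFace (toSite wv, j) = toSite f := by rw [← hj, he_toSite_ofSite]
    rw [hface] at hjump
    simp only at hjump
    rw [← hjump]
    refine he_H_outside ι V hadm hflat hchart hK hLS hh₀ hω hR hs1 hs2 _ ?_ ⟨fcell (toSite f), ?_, ?_⟩
    · rw [mem_cellRegion_vcell_iff, ofSite_toSite]; exact hwc
    · rw [mem_cellRegion_fcell_iff, ofSite_toSite]; exact hfc
    · have hbox : f.1 ≤ wv.1 ∧ wv.1 ≤ f.1 + 1 ∧ f.2 ≤ wv.2 ∧ wv.2 ≤ f.2 + 1 := by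
        simp only [SixVertex.faceCorners, mem_insert, mem_singleton] at hwf
        rcases hwf with h | h | h | h <;> rw [h] <;> (try simp only) <;> omega
      have e1 : vcell (toSite wv) = (wv.1 + wv.2 - 1, wv.2 - wv.1) := by simp [vcell, toSite]
      have e2 : fcell (toSite f) = (f.1 + f.2, f.2 - f.1) := by simp [fcell, toSite]
      rw [e1, e2]
      exact (crr_cellAdj_of_corner hbox).2

include hadm hflat hchart hK hLS hh₀ hω hR hs1 hs2 in
/-- **Heights exist for every consistent arrow assignment on a rainbow configuration** (T5c): the
configuration `h = h₀ + H` on the free cells is valid and has `bit h = s` over the piece (module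
docstring). [cite: BaxterKellandWu1976, §3–§4] -/
theorem he_heightsExist : ∃ h ∈ (ι.model V).configs, ∀ c ∈ cornerSet (ι.model V).piece, (ι.model V).bit h c = s c := by
  classical
  have hdiv := he_div ι V hadm hflat hchart hh₀ hω hR hs1 hs2
  have hval₀ : (ι.model V).IsValid h₀ := (mem_configs_iff_isValid _ h₀).1 hh₀
  have hunitT := unitDifferences_tracked V ι hadm hflat (chart8_of_chart3 hchart) h₀ hval₀
  -- the correction `H` and the new configuration `h = h₀ + H`
  obtain ⟨H, hH⟩ : ∃ H : MedialTrail.Pt → ℤ, ∀ F, H F = ∑ c ∈ cornerSet (ι.model V).piece,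
      (BKW.sgn (s c) - BKW.sgn ((ι.model V).bit h₀ c)) * dartWnd (cornerDart c) F := ⟨_, fun _ => rfl⟩
  obtain ⟨h, hh⟩ : ∃ h : ↥(ι.model V).freeCells → ℤ, ∀ q, h q = h₀ q +
      (bif q.1.2 then H (fcell (toSite q.1.1)) else H (vcell (toSite q.1.1))) := ⟨_, fun _ => rfl⟩
  have HV : ∀ x ∈ (ι.model V).vertexCells, (ι.model V).hv h x = (ι.model V).hv h₀ x + H (vcell (toSite x)) := by
    intro x hx
    by_cases hfree : (x, false) ∈ (ι.model V).freeCells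
    · rw [hv_of_mem _ _ hfree, hv_of_mem _ _ hfree, hh]; rfl
    · have h0 := he_H_vertex ι V hadm hflat hchart hK hLS hh₀ hω hR hs1 hs2 hx hfree
      rw [← hH] at h0
      rw [hv_of_not_mem _ _ hfree, hv_of_not_mem _ _ hfree, h0, add_zero]
  have HF : ∀ f ∈ (ι.model V).faceCells, (ι.model V).hf h f = (ι.model V).hf h₀ f + H (fcell (toSite f)) := by
    intro f hf
    by_cases hfree : (f, true) ∈ (ι.model V).freeCells
    · rw [hf_of_mem _ _ hfree, hf_of_mem _ _ hfree, hh]; rfl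
    · have h0 := he_H_face ι V hadm hflat hchart hK hLS hh₀ hω hR hs1 hs2 hf hfree
      rw [← hH] at h0
      rw [hf_of_not_mem _ _ hfree, hf_of_not_mem _ _ hfree, h0, add_zero]
  -- the jump of `h` at a tracked corner is `sgn (s c)`
  have key : ∀ x ∈ (ι.model V).vertexCells, ∀ j : Fin 4, ofSite (cFace (toSite x, j)) ∈ (ι.model V).faceCells →
      (ι.model V).hv h x - (ι.model V).hf h (ofSite (cFace (toSite x, j))) = BKW.sgn (s (toSite x, j)) := by
    intro x hx j hfc
    have hc : (toSite x, j) ∈ cornerSet (ι.model V).piece := by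
      rw [mem_cornerSet, dict_mem_piece_iff, ofSite_toSite]; exact hx
    have hjump := hw_jump_corner _ _ hdiv (toSite x, j)
    rw [if_pos hc, ← hH, ← hH] at hjump
    simp only at hjump
    have hfx : ofSite (cFace (toSite x, j)) ∈ SixVertex.vertexFaces x := by
      simpa using perCfg_ofSite_cFace_mem_vertexFaces (toSite x, j)
    have hunit := hunitT x hx _ hfx hfc
    have hbit : BKW.sgn ((ι.model V).bit h₀ (toSite x, j)) =
        (ι.model V).hv h₀ x - (ι.model V).hf h₀ (ofSite (cFace (toSite x, j))) := by
      have := he_sgn_decide hunit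
      rw [bit]; simpa only [ofSite_toSite] using this
    rw [HV x hx, HF _ hfc, he_toSite_ofSite]
    linarith
  -- validity
  have hval : (ι.model V).IsValid h := by
    intro x hx f hf hfc _
    obtain ⟨j, hj⟩ := dict_exists_corner_of_vertexFaces hf
    rw [← hj] at hfc ⊢
    rw [key x hx j hfc]
    cases s (toSite x, j) <;> simp [BKW.sgn]
  refine ⟨h, mem_configs_of_isValid _ hval, fun c hc => ?_⟩
  obtain ⟨y, j⟩ := c
  have hx : ofSite y ∈ (ι.model V).vertexCells := by
    rw [mem_cornerSet, dict_mem_piece_iff] at hc; exact hc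
  have hy : (toSite (ofSite y), j) = (y, j) := by rw [he_toSite_ofSite]
  by_cases htr : (ι.model V).IsTracked (y, j)
  · -- tracked: the jump of `h` is `sgn (s c)`
    have hfc : ofSite (cFace (toSite (ofSite y), j)) ∈ (ι.model V).faceCells := by rw [hy]; exact htr.2
    have hk := key (ofSite y) hx j hfc
    rw [hy] at hk
    rw [bit]
    simp only
    rw [hk]
    cases s (y, j) <;> simp [BKW.sgn]
  · -- untracked: both cells prescribed, the corner is a cut
    have hcut : (ι.model V).IsCut (y, j) := by
      by_contra hcut; exact htr (he_tracked_of_not_isCut (ι.model V) hω hcut).1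
    obtain ⟨a1, a2⟩ := heights_indep_of_not_isTracked (ι.model V) hc htr h
    obtain ⟨b1, b2⟩ := heights_indep_of_not_isTracked (ι.model V) hc htr h₀
    rw [hs2 _ hc hcut, bit, bit, a1, a2, b1, b2]

end Model

/-- **`s17_heightsExist`** (registered stub of the D2 completion skeleton on stmt-CriticalPhenomena-14132;
T5c of the insertion dictionary — heights exist for every consistent arrow assignment on a rainbow
configuration): for an ADMISSIBLE leg insertion `ι` on `V` with FLAT insertion points (radius
`sinkLegs + 4`), radius-`3` CHARTS, `V` lattice-connected with king-connected complement and
`6`-KINGCHARTS at the first-layer points, every valid `h₀`, every RAINBOW `ω ⊆ E` and every arrow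
assignment `s` on the corners that is invariant under the turning rule of `cfgOf ω` at the non-cut
corners over the piece and equal to `bit h₀` at the cuts, there is a valid height configuration `h`
with `bit h c = s c` at every corner over the piece. [cite: BaxterKellandWu1976, §3–§4] -/
theorem s17_heightsExist : ∀ (ι : Literature.Probability.LatticeModels.CollarLegModel.LegInsertionData) (V : Finset (ℤ × ℤ)), ι.IsAdmissible V → (∀ x ∈ insert ι.sink ι.source, ∃ dvec : ℤ × ℤ, (dvec = (1, 0) ∨ dvec = (-1, 0) ∨ dvec = (0, 1) ∨ dvec = (0, -1)) ∧ ∀ v : ℤ × ℤ, (v.1 - x.1) ^ 2 + (v.2 - x.2) ^ 2 ≤ ((ι.sinkLegs : ℤ) + 4) ^ 2 → (v ∈ V ↔ 0 ≤ (v.1 - x.1) * dvec.1 + (v.2 - x.2) * dvec.2)) → (∀ u ∈ V, ∀ k : Fin 4, u + Literature.Probability.LatticeModels.CollarLegModel.dir k ∉ V → ∃ (K : Fin 4) (c₁ c₂ : ℤ), (∀ v : ℤ × ℤ, |v.1 - u.1| ≤ 3 → |v.2 - u.2| ≤ 3 → (v ∈ V ↔ c₂ ≤ v.1 * (Literature.Probability.LatticeModels.CollarLegModel.dir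 (K + 1)).1 + v.2 * (Literature.Probability.LatticeModels.CollarLegModel.dir (K + 1)).2)) ∨ (∀ v : ℤ × ℤ, |v.1 - u.1| ≤ 3 → |v.2 - u.2| ≤ 3 → (v ∈ V ↔ c₁ ≤ v.1 * (Literature.Probability.LatticeModels.CollarLegModel.dir K).1 + v.2 * (Literature.Probability.LatticeModels.CollarLegModel.dir K).2 ∧ c₂ ≤ v.1 * (Literature.Probability.LatticeModels.CollarLegModel.dir (K + 1)).1 + v.2 * (Literature.Probability.LatticeModels.CollarLegModel.dir (K + 1)).2)) ∨ (∀ v : ℤ × ℤ, |v.1 - u.1| ≤ 3 → |v.2 - u.2| ≤ 3 → (v ∈ V ↔ c₂ ≤ v.1 * (Literature.Probability.LatticeModels.CollarLegModel.dir (K + 1)).1 + v.2 * (Literature.Probability.LatticeModels.CollarLegModel.dir (K + 1)).2 ∨ v.1 * (Literature.Probability.LatticeModels.CollarLegModel.dir K).1 + v.2 * (Literature.Probability.LatticeModels.CollarLegModel.dir K).2 ≤ c₁))) → (∀ u ∈ V, ∀ w ∈ V, Relation.ReflTransGen (fun b c : ℤ × ℤ ↦ b ∈ V ∧ c ∈ V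 ∧ (b.1 - c.1) ^ 2 + (b.2 - c.2) ^ 2 = 1) u w) → (∀ u ∉ V, ∀ w ∉ V, Relation.ReflTransGen (fun b c : ℤ × ℤ ↦ b ∉ V ∧ c ∉ V ∧ max |b.1 - c.1| |b.2 - c.2| ≤ 1) u w) → (∀ z : ℤ × ℤ, z ∉ V → (∃ v ∈ V, max |v.1 - z.1| |v.2 - z.2| ≤ 1) → ∃ σ τ a c : ℤ, |σ| ≤ 1 ∧ |τ| ≤ 1 ∧ ((∀ v : ℤ × ℤ, max |v.1 - z.1| |v.2 - z.2| ≤ 6 → (v ∈ V ↔ 0 ≤ σ * (v.1 - a) ∧ 0 ≤ τ * (v.2 - c))) ∨ (∀ v : ℤ × ℤ, max |v.1 - z.1| |v.2 - z.2| ≤ 6 → (v ∈ V ↔ 0 < σ * (v.1 - a) ∨ 0 < τ * (v.2 - c))))) → ∀ (h₀ : ↥(ι.model V).freeCells → ℤ), h₀ ∈ (ι.model V).configs → ∀ (ω : Finset ((ℤ × ℤ) × Bool)), ω ⊆ (ι.model V).E → ι.Rainbow V ω → ∀ (s : Literature.Probability.LatticeModels.Site 2 × Fin 4 → Bool), (∀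 c ∈ Literature.Probability.Percolation.cornerSet (ι.model V).piece, ¬(ι.model V).IsCut c → s (Literature.Probability.LatticeModels.nextCorner ((ι.model V).cfgOf ω) c) = s c) → (∀ c ∈ Literature.Probability.Percolation.cornerSet (ι.model V).piece, (ι.model V).IsCut c → s c = (ι.model V).bit h₀ c) → ∃ h ∈ (ι.model V).configs, ∀ c ∈ Literature.Probability.Percolation.cornerSet (ι.model V).piece, (ι.model V).bit h c = s c :=
  fun ι V hadm hflat hchart _ hK hLS _ hh₀ _ hω hR _ hs1 hs2 =>
    he_heightsExist ι V hadm hflat hchart hK hLS hh₀ hω hR hs1 hs2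

end Summit.CriticalPhenomena.CardyFormulaZ2.Cruxes.BoundaryDefectGaussianR.RainbowMonomialsInExcursionKernels
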